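import Summits.BirchSwinnertonDyer.BirchSwinnertonDyer.Theorems.SmallImageMuTransferMuTransferX9KolyvaginCocycleMeetingPoint
import HarnessLib

/-!
# K6 crux `MuTransferX9` (stmt-BirchSwinnertonDyer-19276), skeleton v6 stub `stub_stepsTwoFourOdd`:
# the TAME-GENERATOR SEAM between the Kolyvagin-cocycle meeting point (G3) and the local `q`-term
# (STEP 4 ⊕ Lemma 1 (iii)) — `τq` IS a generator of tame inertia mod `ℓ = N(q)`, in the local currency

Cell `b2b-bsdres` (X9 prover lineage, GEN 45) serving the K6 route `SmallImageMuTransfer` of cell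
`bsd-smallim`.  HONEST FRAMING: the cell deletes COMBINATION-SHAPED residual classes of the rank-≤1
BSD formula from PUBLISHED theorems only and TYPES the construction-shaped remainder; this is not
"finishing BSD"; class X9 stays TYPED at class level.  `--supports` helper toward
stmt-BirchSwinnertonDyer-19276 (`stub_stepsTwoFourOdd` of skeleton v6 `a90a661b046bb403`); books
nothing, closes nothing; THEOREMS ONLY (no definition, no named fact, no `sorry`).

## Why

The assembler of `stub_stepsTwoFourOdd` feeds the Kolyvagin cocycle `c := Φ` of the G3 meeting point
(k6-g3, `KolyvaginTwist.exists_kolyvaginCocycle_meetingPoint`: a tame generator `σ ∈ ℐ_{𝔓₀}`, a LOCAL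
inertia element `τq ∈ I_{ℚ_q}` with `res τq = σ`, the value clause `Φ (res τq) = −a`) into koly's
`hQ`-free STEP 4 (`LocalSplitPrime.convCoeff_eq_zero_of_transverse_of_unramified`), which reads the
transverse class off its value `c (res t₀)` at an element `t₀ ∈ I_{ℚ_q}` that must GENERATE the tame
quotient: hypothesis
`hgen : ∀ u : (ZMod (N q))ˣ, u ∈ Subgroup.zpowers (χ̄_{N q}^{ℚ_q} t₀)` (`N q = Ideal.absNorm q.asIdeal`,
`χ̄` the mod-`N q` cyclotomic character OF THE LOCAL FIELD `ℚ_q`).  To take `t₀ := τq` one needs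
exactly: (i) `σ` generates `Γ_ℚ / Gal(ℚ̄/ℚ(μ_ℓ))`, `ℓ = primesEquiv q` — the clause `hcov` of k6-g3's
`exists_kolyvaginCocycle_rat`, which the meeting point as landed does not re-export; (ii) the
compatibility `χ̄_ℓ^{ℚ}(res τ) = χ̄_ℓ^{ℚ_q}(τ)` of the cyclotomic characters under restriction; (iii)
the two spellings `ℓ = primesEquiv q` (k6-g3, G3a) and `ℓ = Ideal.absNorm q.asIdeal` (koly's local
files) of the same prime, inside `rootsOfUnityFixer ℚ ℓ`, `(ZMod ℓ)ˣ`, `χ̄_ℓ` and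
`CyclotomicField ℓ ℚ_q` (the field of the transverse condition `hcq`).  This file supplies (i)–(iii)
and the meeting point RE-EXPORTED with them.

## What

* §1 (groups; `ℚ`): `forall_mem_zpowers_of_forall_exists_pow_inv_mul_mem_ker` (if the translates
  `σ^i · ker χ` cover `G` and `χ` is onto, `χ(σ)` generates); over `ℚ` with `N = Gal(ℚ̄/ℚ(μ_ℓ)) = ker χ_ℓ`
  (`rootsOfUnityFixer_eq_ker`) and `χ_ℓ` onto (`modNCyclotomicCharacter_rat_surjective`):
  `forall_mem_zpowers_modNCyclotomicCharacter_of_cover`, `…modPCyclotomicCharacterZMod_of_cover`.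
* §2 (local): `forall_mem_zpowers_modPCyclotomicCharacterZMod_of_absGaloisRestrict_eq` — for ANY
  extension `L/ℚ` and `τ ∈ Γ_L` with `res τ = σ`, `χ̄_ℓ^{L}(τ)` generates `(ZMod ℓ)ˣ`
  (`modNCyclotomicCharacter_absGaloisRestrict`); the `absNorm` currency at `L = ℚ_q`:
  `forall_mem_zpowers_modPCyclotomicCharacterZMod_absNorm_of_absGaloisRestrict_eq` — koly's `hgen`
  VERBATIM at `t₀ := τ`; the spelling seams `rootsOfUnityFixer_absNorm_eq_primesEquiv`,
  `transverseSubgroup_cyclotomicField_congr`, `mem_transverseSubgroup_cyclotomicField_absNorm_iff`.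
* §3 `KolyvaginTwist.exists_kolyvaginCocycle_meetingPoint_gen`: the meeting point with the SAME
  hypotheses (plus the two instance binders of koly's local files, `[Fact (N q).Prime]`,
  `[NeZero (N q : ℚ_q)]`) and the SAME conclusion, followed by FOUR more clauses: `hcov`; koly's
  `hgen` at `t₀ := τq` (absNorm currency); `Φ = 0` on `ℐ_{𝔓₀} ∩ Gal(ℚ̄/ℚ(μ_ℓ))`; and `hcq` in the
  absNorm currency `loc_q [Φ] ∈ H¹_tr(ℚ_q, 𝒯_J)` w.r.t. `CyclotomicField (N q) ℚ_q`.  Proof = k6-g3's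
  25-line route from `exists_kolyvaginCocycle_rat` (p454778), keeping the clauses it discarded.

PARTITION (D-0054): X9 (A4) · X10b∧¬Surj (A5) at `p = 3` — Galois-side seam helper toward
`stub_stepsTwoFourOdd`; closes NONE.

References: K. Rubin, *Euler Systems* (2000) §4.4 (the choice of `σ_ℓ` generating `G_ℓ`),
Lemma 4.4.2, Thm. 4.5.1 [Rubin2000]; K. Rubin, PCMI 18 (2011) Def. 1.9.4, Prop. 1.9.5 (transverse
classes read at a tame generator) [Rubin2011]; J.-P. Serre, *Local Fields* (1979) Ch. IV §4
Prop. 17–18 (tame inertia ↠ `(ℤ/ℓ)ˣ`) [SerreLocalFields1979]; J. Neukirch, *Algebraic Number Theory*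
(1999) Ch. I (10.3), Ch. II (9.6) [NeukirchANT1999]; HOME/koly/MU-TRANSFER-PROOF.md §3 Lemma 2,
§5 STEPS 3–4.
-/

-- the summit and its single problem are both named `BirchSwinnertonDyer` (registry layout D-0017)
set_option linter.dupNamespace false

set_option autoImplicit false

noncomputable section

open CategoryTheory Function Finset
open scoped NumberField Pointwise
open Field IsDedekindDomain NumberField
open Literature.NumberTheory.GaloisRepresentations
open Literature.NumberTheory.GaloisRepresentations.IsNonarchimedeanLocalField
open Literature.NumberTheory.EllipticCurves
open Literature.NumberTheory.EllipticCurves.ZpExtension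
open Rat.HeightOneSpectrum
open Summit.BirchSwinnertonDyer.Rank1Residual.GaloisImage

namespace Summit.BirchSwinnertonDyer.BirchSwinnertonDyer.Rank1Residual.TameSeams

/-! ## §1 A covering family of translates of `ker χ` makes `χ(σ)` a generator -/

/-- **If the translates `σ^i · ker χ` cover `G` and `χ : G → A` is onto, then `χ(σ)` generates `A`.**
[cite: Rubin2000, §4.4] -/
theorem forall_mem_zpowers_of_forall_exists_pow_inv_mul_mem_ker {G A : Type*} [Group G] [Group A]
    (χ : G →* A) (hχ : Function.Surjective χ) {σ : G}
    (hcov : ∀ g : G, ∃ i : ℕ, (σ ^ i)⁻¹ * g ∈ χ.ker) :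
    ∀ u : A, u ∈ Subgroup.zpowers (χ σ) := by
  intro u
  obtain ⟨g, rfl⟩ := hχ u
  obtain ⟨i, hi⟩ := hcov g
  rw [MonoidHom.mem_ker, map_mul, map_inv, map_pow, inv_mul_eq_one] at hi
  rw [← hi]
  exact Subgroup.pow_mem _ (Subgroup.mem_zpowers _) i

/-- **Over `ℚ`: if `σ^i · Gal(ℚ̄/ℚ(μ_ℓ))`, `i < n`, cover `Γ_ℚ` then `χ_ℓ(σ)` generates `(ℤ/ℓ)ˣ`**
(`Gal(ℚ̄/ℚ(μ_ℓ)) = ker χ_ℓ` and `χ_ℓ : Γ_ℚ → (ℤ/ℓ)ˣ` is onto).  This is the converse of the tree's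
`CyclotomicLevel.Rat.existsUnique_pow_inv_mul_mem_rootsOfUnityFixer`, and recovers the generator
property from the clause `hcov` exported by `KolyvaginTwist.exists_kolyvaginCocycle_rat`.
[cite: Rubin2000, §4.4] [cite: NeukirchANT1999, Ch. I (10.3)] -/
theorem forall_mem_zpowers_modNCyclotomicCharacter_of_cover {ℓ : ℕ} [NeZero ℓ]
    {σ : absoluteGaloisGroup ℚ} {n : ℕ}
    (hcov : ∀ g : absoluteGaloisGroup ℚ, ∃ i < n, (σ ^ i)⁻¹ * g ∈ rootsOfUnityFixer ℚ ℓ) :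
    ∀ u : (ZMod ℓ)ˣ, u ∈ Subgroup.zpowers (modNCyclotomicCharacter ℚ ℓ σ) := by
  refine forall_mem_zpowers_of_forall_exists_pow_inv_mul_mem_ker _
    (modNCyclotomicCharacter_rat_surjective ℓ) fun g => ?_
  obtain ⟨i, -, hi⟩ := hcov g
  exact ⟨i, by rwa [← rootsOfUnityFixer_eq_ker]⟩

/-- The same for the mod-`ℓ` cyclotomic character in the `modPCyclotomicCharacterZMod` spelling
(`ℓ` prime; definitionally `modNCyclotomicCharacter ℚ ℓ`). [cite: Rubin2000, §4.4] -/
theorem forall_mem_zpowers_modPCyclotomicCharacterZMod_of_cover {ℓ : ℕ} [Fact ℓ.Prime]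
    {σ : absoluteGaloisGroup ℚ} {n : ℕ}
    (hcov : ∀ g : absoluteGaloisGroup ℚ, ∃ i < n, (σ ^ i)⁻¹ * g ∈ rootsOfUnityFixer ℚ ℓ) :
    ∀ u : (ZMod ℓ)ˣ, u ∈ Subgroup.zpowers (modPCyclotomicCharacterZMod ℚ ℓ σ) := by
  haveI : NeZero ℓ := ⟨(Fact.out : ℓ.Prime).ne_zero⟩
  rw [modPCyclotomicCharacterZMod_eq_modNCyclotomicCharacter]
  exact forall_mem_zpowers_modNCyclotomicCharacter_of_cover hcov

/-! ## §2 The local character at a lift: `χ̄_ℓ^{L}(τ) = χ̄_ℓ^{ℚ}(res τ)` generates -/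

/-- **A local lift of a generating `σ` generates**: for any extension `L/ℚ` (`ℓ ≠ 0` in `L`) and
`τ ∈ Γ_L` with `res τ = σ`, where the translates `σ^i · Gal(ℚ̄/ℚ(μ_ℓ))` cover `Γ_ℚ`, the LOCAL
mod-`ℓ` cyclotomic character of `L` at `τ` generates `(ℤ/ℓ)ˣ`
(`modNCyclotomicCharacter_absGaloisRestrict`: `χ_ℓ^{ℚ}(res τ) = χ_ℓ^{L}(τ)`).
[cite: NeukirchANT1999, Ch. II §9 Prop. (9.6)] [cite: SerreLocalFields1979, Ch. IV §4, Prop. 17–18] -/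
theorem forall_mem_zpowers_modPCyclotomicCharacterZMod_of_absGaloisRestrict_eq
    (L : Type*) [Field L] [Algebra ℚ L] {ℓ : ℕ} [Fact ℓ.Prime] [NeZero ((ℓ : ℕ) : L)]
    {σ : absoluteGaloisGroup ℚ} {n : ℕ}
    (hcov : ∀ g : absoluteGaloisGroup ℚ, ∃ i < n, (σ ^ i)⁻¹ * g ∈ rootsOfUnityFixer ℚ ℓ)
    {τ : absoluteGaloisGroup L} (hτ : absGaloisRestrict ℚ L τ = σ) :
    ∀ u : (ZMod ℓ)ˣ, u ∈ Subgroup.zpowers (modPCyclotomicCharacterZMod L ℓ τ) := by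
  haveI : NeZero ℓ := ⟨(Fact.out : ℓ.Prime).ne_zero⟩
  rw [modPCyclotomicCharacterZMod_eq_modNCyclotomicCharacter,
    ← modNCyclotomicCharacter_absGaloisRestrict ℚ L ℓ τ, hτ]
  exact forall_mem_zpowers_modNCyclotomicCharacter_of_cover hcov

/-- **The two spellings of the prime of `q`** inside `Gal(ℚ̄/ℚ(μ_ℓ))`:
`rootsOfUnityFixer ℚ (N q) = rootsOfUnityFixer ℚ (primesEquiv q)` (`N q = Ideal.absNorm q.asIdeal`,
tree `LFunctions.absNorm_asIdeal_eq_primesEquiv`). [cite: NeukirchANT1999, Ch. I (10.3)] -/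
theorem rootsOfUnityFixer_absNorm_eq_primesEquiv (q : HeightOneSpectrum (𝓞 ℚ)) :
    rootsOfUnityFixer ℚ (Ideal.absNorm q.asIdeal) =
      rootsOfUnityFixer ℚ ((primesEquiv q : Nat.Primes) : ℕ) := by
  rw [Literature.NumberTheory.LFunctions.absNorm_asIdeal_eq_primesEquiv]

/-- **koly's `hgen` at a local lift of k6-g3's generator, in the `absNorm` currency**: for
`τ ∈ Γ_{ℚ_q}` with `res τ = σ` and `σ^i · Gal(ℚ̄/ℚ(μ_ℓ))` (`ℓ = primesEquiv q`, `i < n`) covering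
`Γ_ℚ`, every unit of `ℤ/N(q)` is a power of `χ̄_{N q}^{ℚ_q}(τ)` — the hypothesis `hgen` of
`LocalSplitPrime.convCoeff_eq_zero_of_transverse_of_unramified` /
`LocalSplitPrime.exists_unit_qTermIdentity` at `t₀ := τ`, verbatim.
[cite: SerreLocalFields1979, Ch. IV §4, Prop. 17–18] [cite: Rubin2011, Def. 1.9.4] -/
theorem forall_mem_zpowers_modPCyclotomicCharacterZMod_absNorm_of_absGaloisRestrict_eq
    (q : HeightOneSpectrum (𝓞 ℚ)) [Fact (Ideal.absNorm q.asIdeal).Prime]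
    [NeZero ((Ideal.absNorm q.asIdeal : ℕ) : q.adicCompletion ℚ)]
    {σ : absoluteGaloisGroup ℚ} {n : ℕ}
    (hcov : ∀ g : absoluteGaloisGroup ℚ, ∃ i < n,
      (σ ^ i)⁻¹ * g ∈ rootsOfUnityFixer ℚ ((primesEquiv q : Nat.Primes) : ℕ))
    {τ : absoluteGaloisGroup (q.adicCompletion ℚ)}
    (hτ : absGaloisRestrict ℚ (q.adicCompletion ℚ) τ = σ) :
    ∀ u : (ZMod (Ideal.absNorm q.asIdeal))ˣ,
      u ∈ Subgroup.zpowers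
        (modPCyclotomicCharacterZMod (q.adicCompletion ℚ) (Ideal.absNorm q.asIdeal) τ) := by
  have hcov' : ∀ g : absoluteGaloisGroup ℚ, ∃ i < n,
      (σ ^ i)⁻¹ * g ∈ rootsOfUnityFixer ℚ (Ideal.absNorm q.asIdeal) := by
    rw [rootsOfUnityFixer_absNorm_eq_primesEquiv]; exact hcov
  exact forall_mem_zpowers_modPCyclotomicCharacterZMod_of_absGaloisRestrict_eq _ hcov' hτ

/-- **The field of the transverse condition does not see the spelling of `ℓ`**:
`H¹_tr(F, M)` w.r.t. `CyclotomicField a F` and w.r.t. `CyclotomicField b F` coincide for `a = b`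
(transport of the `ℕ`-index; used with `a = N q`, `b = primesEquiv q`). [cite: Rubin2011, Def. 1.9.4] -/
theorem transverseSubgroup_cyclotomicField_congr {F : Type} [Field F] {M : Type} [AddCommGroup M]
    [TopologicalSpace M] [DiscreteTopology M] (ρF : DiscreteGaloisModule F M) {a b : ℕ} (h : a = b) :
    DiscreteGaloisModule.transverseSubgroup ρF (CyclotomicField a F) =
      DiscreteGaloisModule.transverseSubgroup ρF (CyclotomicField b F) := by
  subst h; rfl

/-- **`hcq` in either currency**: for a discrete `Γ_ℚ`-module `X` and a class `c ∈ H¹(ℚ_q, X|_{ℚ_q})`,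
`c` is transverse w.r.t. `ℚ_q(μ_{N q})` iff it is transverse w.r.t. `ℚ_q(μ_ℓ)`, `ℓ = primesEquiv q`
(the same field). [cite: Rubin2011, Def. 1.9.4] -/
theorem mem_transverseSubgroup_cyclotomicField_absNorm_iff (q : HeightOneSpectrum (𝓞 ℚ))
    {M : Type} [AddCommGroup M] [TopologicalSpace M] [DiscreteTopology M]
    (ρq : DiscreteGaloisModule (q.adicCompletion ℚ) M) (c : galoisCohomology ρq 1) :
    c ∈ DiscreteGaloisModule.transverseSubgroup ρq
        (CyclotomicField (Ideal.absNorm q.asIdeal) (q.adicCompletion ℚ)) ↔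
      c ∈ DiscreteGaloisModule.transverseSubgroup ρq
        (CyclotomicField ((primesEquiv q : Nat.Primes) : ℕ) (q.adicCompletion ℚ)) := by
  rw [transverseSubgroup_cyclotomicField_congr ρq
    (Literature.NumberTheory.LFunctions.absNorm_asIdeal_eq_primesEquiv q)]


/-! ## §3 The meeting point re-exported with the generator clauses -/

section MeetingPoint

open Summit.BirchSwinnertonDyer.BirchSwinnertonDyer.Rank1Residual.KolyvaginTwist

variable {p : ℕ} [Fact p.Prime] {M : Type} [AddCommGroup M] [TopologicalSpace M]
  [DiscreteTopology M] (κ : ZpExtension ℚ p) (ρ : DiscreteGaloisModule ℚ M)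
  (hM : ∀ m : M, p • m = 0) (J : ℕ)

/-- **The Kolyvagin cocycle at the G3/G4 meeting point, WITH the tame-generator clauses**: the
hypotheses and the first thirteen clauses of the conclusion are VERBATIM those of k6-g3's
`KolyvaginTwist.exists_kolyvaginCocycle_meetingPoint` (data `σ ∈ ℐ_{𝔓₀}`, `τq ∈ I_{ℚ_q}` with
`res τq = σ`, `σ^(ℓ−1) ∈ N`, `σ` trivial on `𝒯_J`, the cocycle `Φ` with `Φ|_N = Σ i•σ^i·y`, a norm
witness, the value clause `Φ(res τq) = −a`, `res[Φ] = D[y]` uniquely, `hx` at `w ≠ q`, and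
`loc_q[Φ] ∈ H¹_tr` w.r.t. `ℚ_q(μ_ℓ)`, `ℓ = primesEquiv q`), with two extra instance binders
(`[Fact (N q).Prime]`, `[NeZero (N q : ℚ_q)]`, `N q = Ideal.absNorm q.asIdeal` — the section
variables of koly's local files), FOLLOWED BY FOUR MORE CLAUSES:
(14) `hcov`: the translates `σ^i · Gal(ℚ̄/ℚ(μ_ℓ))`, `i < ℓ − 1`, cover `Γ_ℚ` (from k6-g3's
`exists_kolyvaginCocycle_rat`); (15) koly's **`hgen` at `t₀ := τq`** in the `absNorm` currency —
every unit of `ℤ/N(q)` is a power of `χ̄_{N q}^{ℚ_q}(τq)` — so that `c := Φ`, `t₀ := τq` may be fed to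
`LocalSplitPrime.convCoeff_eq_zero_of_transverse_of_unramified` with `c.1 (res t₀) = −a`;
(16) `Φ` vanishes on `ℐ_{𝔓₀} ∩ Gal(ℚ̄/ℚ(μ_ℓ))`; (17) **`hcq` in the `absNorm` currency**:
`loc_q[Φ] ∈ H¹_tr(ℚ_q, 𝒯_J)` w.r.t. `CyclotomicField (N q) ℚ_q`.  The INPUT cocycle `y` (G3a) is
not produced here.
[cite: Rubin2000, Def. 4.4.4, Lemma 4.4.2 and Thm. 4.5.1] [cite: Rubin2011, Def. 1.9.4 and Prop. 1.9.5] -/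
theorem exists_kolyvaginCocycle_meetingPoint_gen (hp2 : p ≠ 2) (q : HeightOneSpectrum (𝓞 ℚ))
    [NeZero ((primesEquiv q : Nat.Primes) : ℕ)] [Fact (((primesEquiv q : Nat.Primes) : ℕ)).Prime]
    [NeZero ((((primesEquiv q : Nat.Primes) : ℕ) : ℕ) : q.adicCompletion ℚ)]
    [Fact (Ideal.absNorm q.asIdeal).Prime]
    [NeZero ((Ideal.absNorm q.asIdeal : ℕ) : q.adicCompletion ℚ)]
    [hNn : (rootsOfUnityFixer ℚ ((primesEquiv q : Nat.Primes) : ℕ)).Normal]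
    [Fintype (absoluteGaloisGroup ℚ ⧸ rootsOfUnityFixer ℚ ((primesEquiv q : Nat.Primes) : ℕ))]
    (hfix : ∀ m : M,
      (∀ g ∈ rootsOfUnityFixer ℚ ((primesEquiv q : Nat.Primes) : ℕ), ρ g m = m) → m = 0)
    (hpq : (p : 𝓞 ℚ) ∉ q.asIdeal) (hunr : GaloisRep.IsUnramifiedAt q ρ)
    (hdvd : p ∣ ((primesEquiv q : Nat.Primes) : ℕ) - 1)
    (y : contOneCocycles (subgroupRep (κ.twistModP ρ hM J).toTopRep
      (rootsOfUnityFixer ℚ ((primesEquiv q : Nat.Primes) : ℕ))))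
    (hyI : ∀ w : HeightOneSpectrum (𝓞 ℚ), (p : 𝓞 ℚ) ∉ w.asIdeal → ∀ 𝔓 ∈ w.primesAbove,
      resLe (κ.twistModP ρ hM J).toTopRep
        (inf_le_left : rootsOfUnityFixer ℚ ((primesEquiv q : Nat.Primes) : ℕ) ⊓
          𝔓.inertia (absoluteGaloisGroup ℚ) ≤ _) 1 (oneCocycleClass _ y) = 0)
    (h𝒩 : resSubgroup (κ.twistModP ρ hM J).toTopRep
        (rootsOfUnityFixer ℚ ((primesEquiv q : Nat.Primes) : ℕ)) 1
      (cores (κ.twistModP ρ hM J).toTopRep (rootsOfUnityFixer ℚ ((primesEquiv q : Nat.Primes) : ℕ))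
        (isOpen_rootsOfUnityFixer ℚ _) (oneCocycleClass _ y)) = 0) :
    ∃ σ ∈ (adicCompletionPrime ℚ q).inertia (absoluteGaloisGroup ℚ),
      ∃ τq ∈ absInertia (q.adicCompletion ℚ),
      absGaloisRestrict ℚ (q.adicCompletion ℚ) τq = σ ∧
      σ ^ (((primesEquiv q : Nat.Primes) : ℕ) - 1) ∈
          rootsOfUnityFixer ℚ ((primesEquiv q : Nat.Primes) : ℕ) ∧
      (∀ x : Fin J → M, κ.twistModP ρ hM J σ x = x) ∧
      ∃ Φ : contOneCocycles (κ.twistModP ρ hM J).toTopRep,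
        (∀ u : rootsOfUnityFixer ℚ ((primesEquiv q : Nat.Primes) : ℕ),
          Φ.1 u = ∑ i ∈ range (((primesEquiv q : Nat.Primes) : ℕ) - 1),
            (i : ℤ) • (κ.twistModP ρ hM J).toTopRep.ρ (σ ^ i) (y.1 (subgroupConj _ (σ ^ i) u))) ∧
        (∃ a : Fin J → M, ∀ u : rootsOfUnityFixer ℚ ((primesEquiv q : Nat.Primes) : ℕ),
          ∑ i ∈ range (((primesEquiv q : Nat.Primes) : ℕ) - 1),
            (κ.twistModP ρ hM J).toTopRep.ρ (σ ^ i) (y.1 (subgroupConj _ (σ ^ i) u)) =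
            (κ.twistModP ρ hM J).toTopRep.ρ (u : absoluteGaloisGroup ℚ) a - a) ∧
        (∀ a : Fin J → M, (∀ u : rootsOfUnityFixer ℚ ((primesEquiv q : Nat.Primes) : ℕ),
          ∑ i ∈ range (((primesEquiv q : Nat.Primes) : ℕ) - 1),
            (κ.twistModP ρ hM J).toTopRep.ρ (σ ^ i) (y.1 (subgroupConj _ (σ ^ i) u)) =
            (κ.twistModP ρ hM J).toTopRep.ρ (u : absoluteGaloisGroup ℚ) a - a) →
          Φ.1 (absGaloisRestrict ℚ (q.adicCompletion ℚ) τq) = -a) ∧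
        resSubgroup (κ.twistModP ρ hM J).toTopRep
            (rootsOfUnityFixer ℚ ((primesEquiv q : Nat.Primes) : ℕ)) 1 (oneCocycleClass _ Φ) =
          ∑ i ∈ range (((primesEquiv q : Nat.Primes) : ℕ) - 1),
            i • conjMap (κ.twistModP ρ hM J).toTopRep
              (rootsOfUnityFixer ℚ ((primesEquiv q : Nat.Primes) : ℕ)) (σ ^ i) 1 (oneCocycleClass _ y) ∧
        (∀ κ' : continuousCohomology 1 (κ.twistModP ρ hM J).toTopRep,
          resSubgroup (κ.twistModP ρ hM J).toTopRep
              (rootsOfUnityFixer ℚ ((primesEquiv q : Nat.Primes) : ℕ)) 1 κ' =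
            ∑ i ∈ range (((primesEquiv q : Nat.Primes) : ℕ) - 1),
              i • conjMap (κ.twistModP ρ hM J).toTopRep
                (rootsOfUnityFixer ℚ ((primesEquiv q : Nat.Primes) : ℕ)) (σ ^ i) 1 (oneCocycleClass _ y) →
          κ' = oneCocycleClass _ Φ) ∧
        (∀ w : HeightOneSpectrum (𝓞 ℚ), w ≠ q → (p : 𝓞 ℚ) ∉ w.asIdeal →
          GaloisRep.IsUnramifiedAt w ρ →
          galoisCohomology.localization (κ.twistModP ρ hM J) (Sum.inr w) 1 (oneCocycleClass _ Φ) ∈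
            DiscreteGaloisModule.unramifiedSubgroup (GaloisRep.toLocal w (κ.twistModP ρ hM J)) 1) ∧
        galoisCohomology.localization (κ.twistModP ρ hM J) (Sum.inr q) 1 (oneCocycleClass _ Φ) ∈
          DiscreteGaloisModule.transverseSubgroup (GaloisRep.toLocal q (κ.twistModP ρ hM J))
            (CyclotomicField ((primesEquiv q : Nat.Primes) : ℕ) (q.adicCompletion ℚ)) ∧
        -- (14) `hcov`: `σ` generates `Γ_ℚ / Gal(ℚ̄/ℚ(μ_ℓ))`
        (∀ g : absoluteGaloisGroup ℚ, ∃ i < ((primesEquiv q : Nat.Primes) : ℕ) - 1,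
          (σ ^ i)⁻¹ * g ∈ rootsOfUnityFixer ℚ ((primesEquiv q : Nat.Primes) : ℕ)) ∧
        -- (15) koly's `hgen` at `t₀ := τq`, `absNorm` currency
        (∀ u : (ZMod (Ideal.absNorm q.asIdeal))ˣ,
          u ∈ Subgroup.zpowers
            (modPCyclotomicCharacterZMod (q.adicCompletion ℚ) (Ideal.absNorm q.asIdeal) τq)) ∧
        -- (16) `Φ` vanishes on `ℐ_{𝔓₀} ∩ Gal(ℚ̄/ℚ(μ_ℓ))`
        (∀ τ ∈ (adicCompletionPrime ℚ q).inertia (absoluteGaloisGroup ℚ),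
          τ ∈ rootsOfUnityFixer ℚ ((primesEquiv q : Nat.Primes) : ℕ) → Φ.1 τ = 0) ∧
        -- (17) `hcq`, `absNorm` currency
        galoisCohomology.localization (κ.twistModP ρ hM J) (Sum.inr q) 1 (oneCocycleClass _ Φ) ∈
          DiscreteGaloisModule.transverseSubgroup (GaloisRep.toLocal q (κ.twistModP ρ hM J))
            (CyclotomicField (Ideal.absNorm q.asIdeal) (q.adicCompletion ℚ)) := by
  -- proof route adapted from k6-g3's `exists_kolyvaginCocycle_meetingPoint` (p458422), keeping
  -- the clauses `hcov` and `hΦI` of `exists_kolyvaginCocycle_rat` (p454778)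
  obtain ⟨σ, hσI, hσn, hcov, hσ, Φ, hΦN, hwit, hval, hres, huniq, hΦI, hnorm⟩ :=
    exists_kolyvaginCocycle_rat κ ρ hM J hp2 q hfix hpq hunr hdvd
      (adicCompletionPrime_mem_primesAbove ℚ q) y
      (hyI q hpq _ (adicCompletionPrime_mem_primesAbove ℚ q)) h𝒩
  -- a local inertia element over `σ`
  have hσ' : σ ∈ (absInertia (q.adicCompletion ℚ)).map
      (absGaloisRestrict ℚ (q.adicCompletion ℚ)).toMonoidHom := by
    rw [← inertia_adicCompletionPrime_eq_map_absInertia]; exact hσI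
  obtain ⟨τq, hτq, hτqσ⟩ := Subgroup.mem_map.mp hσ'
  have hτqσ' : absGaloisRestrict ℚ (q.adicCompletion ℚ) τq = σ := hτqσ
  -- transverse at `q` (k6-g3's currency)
  have htr : galoisCohomology.localization (κ.twistModP ρ hM J) (Sum.inr q) 1 (oneCocycleClass _ Φ) ∈
      DiscreteGaloisModule.transverseSubgroup (GaloisRep.toLocal q (κ.twistModP ρ hM J))
        (CyclotomicField ((primesEquiv q : Nat.Primes) : ℕ) (q.adicCompletion ℚ)) :=
    localization_mem_transverseSubgroup_of_forall_apply_eq_zero (κ.twistModP ρ hM J) q _ Φ hnorm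
  refine ⟨σ, hσI, τq, hτq, hτqσ', hσn, hσ, Φ, hΦN, hwit, fun a ha => ?_, hres, huniq,
    fun w hwq hwp hwunr => ?_, htr, hcov,
    forall_mem_zpowers_modPCyclotomicCharacterZMod_absNorm_of_absGaloisRestrict_eq q hcov hτqσ',
    hΦI, (mem_transverseSubgroup_cyclotomicField_absNorm_iff q _ _).2 htr⟩
  · -- the value clause at `res τq = σ`
    rw [hτqσ']
    exact hval a ha
  · -- `hx`: unramified at `w ≠ q`, `w ∤ p`
    have hwN : ∀ 𝔓 ∈ w.primesAbove, 𝔓.inertia (absoluteGaloisGroup ℚ) ≤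
        rootsOfUnityFixer ℚ ((primesEquiv q : Nat.Primes) : ℕ) :=
      rootsOfUnityFixer_unramifiedAt_of_not_mem ℚ _ (natCast_primesEquiv_not_mem_of_ne hwq)
    have hX : ∀ 𝔓 ∈ w.primesAbove, ∀ τ ∈ 𝔓.inertia (absoluteGaloisGroup ℚ),
        ∀ x : (κ.twistModP ρ hM J).toTopRep, (κ.twistModP ρ hM J).toTopRep.ρ τ x = x :=
      fun 𝔓 h𝔓 τ hτ x => twistModP_apply_eq_self_of_mem_inertia κ ρ hM J hwp hwunr h𝔓 hτ x
    have hy := forall_primesAbove_apply_eq_zero_of_resLe_inf_eq_zero _ _ hwN hX y (hyI w hwp)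
    exact localization_mem_unramifiedSubgroup_of_forall_inertia_apply_eq_zero (κ.twistModP ρ hM J) w Φ
      fun τ hτ => derivCocycle_apply_eq_zero_of_forall_primesAbove _ _ hwN σ _ y hy Φ hΦN
        (adicCompletionPrime_mem_primesAbove ℚ w) hτ

end MeetingPoint

end Summit.BirchSwinnertonDyer.BirchSwinnertonDyer.Rank1Residual.TameSeams

end
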